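/-
Copyright (c) 2026 the pub-hodgecm-mathlib formalisation cell (harness21).  Prover seat hodgecm-mathlib-A-p19 (g19), topic T5 = P8
«(C♯)hol interior», node Cc (3′) brick (T2) «operator read-back along an archimedean element» (desk F0P2-plan (g8) «=» 21:36:48Z /
F0P3a-p03 (g8) 21:36:29Z split: A-p19 assembles).  KERNEL: theorems only.
-/
import Literature.NumberTheory.Automorphic.Liu2021.Def411WeilCarriersArchPlaceGaussian
import HarnessLib

/-!
# One definite archimedean place through the splitting attached to `χ`, ON A GENERAL ARCHIMEDEAN VECTOR: the OPERATOR read-back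
# `ω(ι_χ((u at w(v₀)) ⊗ 1_W))(a₁ ⊗ f) = c • (a₁′ ⊗ f)` from the doubled archimedean operator on box vectors
# ([Kudla1994, §2, Thm. 3.1]; [GelbartRogawski1991, §3.1]; [KonnoKonno2007, Lem. 5.2])

Topic `NumberTheory/Automorphic/Liu2021` (T5 = P8 «(C♯)hol interior», node Cc (3′)); namespace
`Literature.NumberTheory.GelbartRogawski1991.GRConstruction`.  KERNEL ONLY: proved theorems; 0 definitions, 0 records, 0 `sorry`.

The tree reads the UNDOUBLED splitting `s(g) = undouble sD g` (for `sD = doubledWeilRep χ`: `ι_χ(g) = chiSplitting χ g`) on a pure tensor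
`a₁ ⊗ f₁` in two situations: when the doubled operator `ω(sD(g ⊕ 1))` is a FINITE operator `1 ⊗ B` (★ `omega_undouble_tmul`,
`omega_undouble_eq_adelicTensorEnd`), and when it is an ARCHIMEDEAN operator `c • (A ⊗ 1)` having the box vector `R_{e₂}(a₁ ⊠ a₂)` as an
EIGENVECTOR (★ `omega_undouble_tmul_eq_smul_of_arch` — enough for the Gaussian, (J-plc-G) ★ `omega_chiSplitting_placePair_gaussianV_tmul`).
Node Cc's step (3′) («the theta functional kills every non-trivial `U(V_w)`-type at a definite place `w ≠ w(ι)`») needs the archimedean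
read-back for a GENERAL archimedean test vector `a₁` (a Hermite function of positive degree at the place is not an eigenvector of a
non-diagonal `u ∈ U(V_w)`).  This file supplies it:

* §1 **`omega_undouble_tmul_of_arch_box`** — for any `sD` over the doubled homomorphism (`hproj`) and any pair-group element `g`: if
  `ω(sD(g ⊕ 1))(R_{e₂}(a₁ ⊠ a₂) ⊗ f′) = c • (R_{e₂}(a₁′ ⊠ a₂) ⊗ f′)` for all finite `f′` (the doubled archimedean operator moves the box
  vector `a₁ ⊠ a₂` to the box vector `a₁′ ⊠ a₂` — only the FIRST factor moves) and `a₂ ⊗ f₂ ≠ 0` for one `f₂`, then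
  `ω(s(g))(a₁ ⊗ f₁) = c • (a₁′ ⊗ f₁)` for every `f₁` (product formula ★ `omega_uD_tensorToSum` + `⊠ Φ₂`-cancellation); the operator
  form **`omega_undouble_eq_smul_adelicTensorEnd_of_arch`**: if this holds for all `a₁` with `a₁′ = B a₁`, `B` linear, then
  `ω(s(g)) = c • (B ⊗ 1)` (`linearMap_ext_tensor`);
* §2 **`omega_chiSplitting_placePair_tmul_of_box`** — the (C♯) data (`sD = doubledWeilRep χ`, `χ` unitary splitting character of odd
  unitary archimedean type `(τ, 0)`, a real place `v₀`, `u ∈ U(σ_{w(v₀)} diag dV)(ℂ)`): the doubled operator at `(placePair u) ⊕ 1` IS the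
  explicit archimedean half `archHalfOf τ k_{v₀,u}` (★ `doubledWeilRep_archToAdelic_eq_archHalfOf`, ★ `archToAdelic_archKPlace`), which acts on
  `a ⊗ f′` by `η_τ(k_{v₀,u}) • ((frameD^* sectionD(k_{v₀,u}) frameD_* a) ⊗ f′)` (★ `omega_archHalfOf_tmul`); so ONE hypothesis on Folland's
  section in the doubled frame — `frameD^* sectionD(k_{v₀,u}) frameD_* (R_{e₂}(a₁ ⊠ a₂)) = c • R_{e₂}(a₁′ ⊠ a₂)` — gives
  `ω(ι_χ(placePair u))(a₁ ⊗ f) = (η_τ(k_{v₀,u}) c) • (a₁′ ⊗ f)`; operator form **`omega_chiSplitting_placePair_eq_smul_adelicTensorEnd`**;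
* §3 the same through **`pairRep … (chiSplitting χ) (adelicSingle (w(v₀)) u, 1)`** and, at the hermitian line `⟨T_W⟩`, through
  **`pairRep … (chiSplittingLine χ T_W J_W) (adelicSingle (w(v₀)) u, 1)`** (★ `pairSplitting_apply`, ★ `pairRep_splittingCongr_inl_one`) —
  the currency of the theta functional of node Cc (★ `ThetaLiftFromLineCompactInvariance`).

The remaining hypothesis (the block form of `sectionD(k_{v₀,u})` on box vectors: `k_{v₀,u}` is `u ⊗ 1_W` on the first copy at `w(v₀)` and `1`
elsewhere, ★ `coe_archAt_archKPlace`; Folland's section of a sign-block compact element is `vac • μ₀(U)`, ★ `MpS.apply_eq_vac_div_vac_smul` /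
`exists_proj_sectionD_archKPlace`) is brick β of the Cc (3′) road note and is NOT discharged here.

HONEST SCOPE.  Statements about the tree's own Weil-representation terms; nothing of [Liu2021] is asserted; HC_CM is NOT proved here or anywhere
in the tree.

References: [Kudla1994] S. Kudla, Israel J. Math. 87 (1994), §2 (doubled space, Siegel parabolic), Thm. 3.1; [GelbartRogawski1991] §3.1
Prop. 3.1.1 p. 455; [KonnoKonno2007] Lemma 5.2 p. 73; [HarrisKudlaSweet1996] §1 (1.14)–(1.16); [BorelJacquet1979] §4.1.
-/

set_option autoImplicit false

noncomputable section

open scoped Classical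
open scoped Matrix Kronecker TensorProduct SchwartzMap
open NumberField NumberField.InfinitePlace NumberField.mixedEmbedding IsDedekindDomain
open Literature.RepresentationTheory.HeisenbergGroup
open Literature.NumberTheory.Automorphic Literature.NumberTheory.Automorphic.UnitaryGroup
open Literature.NumberTheory.Weil1964
open Literature.RepresentationTheory.HarrisKudlaSweet1996
open Literature.NumberTheory.GaloisRepresentations
open Literature.Analysis.SegalBargmann

namespace Literature.NumberTheory.GelbartRogawski1991.GRConstruction

open UnitaryDualPair UnitaryDualPair.ArchSplitting
open Literature.NumberTheory.GelbartRogawski1991.UnitaryDualPair.LocalSplitting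
open Literature.NumberTheory.Automorphic.Liu2021.Def411WeilCarriersDoubling (doubledWeilRep chiSplitting isDoubledWeilRep_doubledWeilRep)

variable (L : Type) [Field L] [NumberField L] [IsCMField L]

variable {N M n : ℕ} (e : Fin N × Fin M ≃ Fin n)
  (dV : Fin N → L) (hdV : ∀ i, IsCMField.complexConj L (dV i) = dV i) (hdV0 : ∀ i, dV i ≠ 0)
  (dW : Fin M → L) (hdW : ∀ i, IsCMField.complexConj L (dW i) = dW i) (hdW0 : ∀ i, dW i ≠ 0)

/-! ## §1 The operator read-back along an archimedean element (any `sD`) -/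

section ReadBack

variable {sD : HA L e dV hdV dW hdW →* MpD L e dV hdV dW hdW}

/-- **`ω(u(g))` on a product of pure tensors when the doubled archimedean operator moves the first box factor**: if
`ω(sD(g ⊕ 1))(R_{e₂}(a₁ ⊠ a₂) ⊗ f′) = c • (R_{e₂}(a₁′ ⊠ a₂) ⊗ f′)` for all `f′`, then
`ω(u(g))((a₁ ⊗ f₁) ⊠ (a₂ ⊗ f₂)) = (c • (a₁′ ⊗ f₁)) ⊠ (a₂ ⊗ f₂)` (★ `omega_uD_apply`, `R_{e₂}` of a product of pure tensors).
[cite: Kudla1994, §2 (doubled space, Siegel parabolic), Thm. 3.1] [cite: Weil1964, Chap. III n° 38 p. 189] -/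
theorem omega_uD_tensorToSum_tmul_of_arch_box (sD : HA L e dV hdV dW hdW →* MpD L e dV hdV dW hdW)
    (g : UnitaryGroup.adelicPair (Fp L) L (IsCMField.complexConj L) N M (Matrix.diagonal dV) (Matrix.diagonal dW))
    {a₁ a₁' a₂ : 𝓢((Fin n → mixedSpace (Fp L)), ℂ)} {c : ℂ}
    (hA : ∀ f' : FinSB (Fp L) (Fin (n + n)),
      adelicMpCont.omega (Fp L) (Fin (n + n)) (gramDA L e dV hdV dW hdW) (sD (inlG L e dV hdV dW hdW g))
          (piSchwartzBruhatEquiv (Fp L) (Fin (n + n)) (schwartzReindexCLM (Fp L) (e₂ (n := n)) (archBoxTensor a₁ a₂) ⊗ₜ f')) =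
        c • piSchwartzBruhatEquiv (Fp L) (Fin (n + n)) (schwartzReindexCLM (Fp L) (e₂ (n := n)) (archBoxTensor a₁' a₂) ⊗ₜ f'))
    (f₁ f₂ : FinSB (Fp L) (Fin n)) :
    adelicMpCont.omega (Fp L) (Fin n ⊕ Fin n) (gramS L e dV hdV dW hdW) (uD L e dV hdV dW hdW sD g)
        (tensorToSum (Fp L) (Fin n) (Fin n) (piSchwartzBruhatEquiv (Fp L) (Fin n) (a₁ ⊗ₜ f₁))
          (piSchwartzBruhatEquiv (Fp L) (Fin n) (a₂ ⊗ₜ f₂))) =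
      tensorToSum (Fp L) (Fin n) (Fin n) (c • piSchwartzBruhatEquiv (Fp L) (Fin n) (a₁' ⊗ₜ f₁))
        (piSchwartzBruhatEquiv (Fp L) (Fin n) (a₂ ⊗ₜ f₂)) := by
  -- (as in ★ `omega_uD_tensorToSum_tmul_of_arch`: compose `ω(u(g)) = R⁻¹ ∘ ω(sD(g ⊕ 1)) ∘ R`, `R` of a product of pure tensors, `hA`)
  have h1 := omega_uD_apply L e dV hdV dW hdW sD g
    (tensorToSum (Fp L) (Fin n) (Fin n) (piSchwartzBruhatEquiv (Fp L) (Fin n) (a₁ ⊗ₜ f₁))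
      (piSchwartzBruhatEquiv (Fp L) (Fin n) (a₂ ⊗ₜ f₂)))
  have h2 := piSBReindex_tensorToSum_tmul (Fp L) (e₂ (n := n)) a₁ f₁ a₂ f₂
  have h3 := hA (finSBReindex (Fp L) (e₂ (n := n)) (finSumEquiv (Fp L) (Fin n) (Fin n) (f₁ ⊗ₜ f₂)))
  have h4 := h1.trans (congrArg (piSBReindex (Fp L) (e₂ (n := n)).symm)
    ((congrArg (adelicMpCont.omega (Fp L) (Fin (n + n)) (gramDA L e dV hdV dW hdW) (sD (inlG L e dV hdV dW hdW g))) h2).trans h3))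
  have h5 := piSBReindex_symm_tmul_eq_tensorToSum (Fp L) (e₂ (n := n)) a₁' f₁ a₂ f₂
  exact h4.trans (((piSBReindex (Fp L) (e₂ (n := n)).symm).map_smul c _).trans
    ((congrArg (fun z : piSchwartzBruhat (Fp L) (Fin n ⊕ Fin n) => c • z) h5).trans
      ((tensorToSum (Fp L) (Fin n) (Fin n)).map_smul₂ c _ _).symm))

/-- **THE OPERATOR READ-BACK ALONG AN ARCHIMEDEAN ELEMENT**: if the doubled operator `ω(sD(g ⊕ 1))` moves the box vector
`R_{e₂}(a₁ ⊠ a₂)` to `c • R_{e₂}(a₁′ ⊠ a₂)` (uniformly in the finite factor) and `a₂ ⊗ f₂ ≠ 0` for one `f₂`, then the undoubled splitting acts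
on the pure tensor by `ω(s(g))(a₁ ⊗ f₁) = c • (a₁′ ⊗ f₁)` (product formula ★ `omega_uD_tensorToSum` + `⊠ Φ₂`-cancellation
★ `tensorToSum_left_cancel`).  The EIGENVALUE case `a₁′ = λ • a₁` is ★ `omega_undouble_tmul_eq_smul_of_arch`.
[cite: Kudla1994, §2 (doubled space, Siegel parabolic), Thm. 3.1] [cite: HarrisKudlaSweet1996, §1 (1.14)–(1.16)] -/
theorem omega_undouble_tmul_of_arch_box (hproj : ∀ h, projD L e dV hdV dW hdW (sD h) = toSpD L e dV hdV dW hdW h)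
    (g : UnitaryGroup.adelicPair (Fp L) L (IsCMField.complexConj L) N M (Matrix.diagonal dV) (Matrix.diagonal dW))
    {a₁ a₁' a₂ : 𝓢((Fin n → mixedSpace (Fp L)), ℂ)} {c : ℂ}
    (hA : ∀ f' : FinSB (Fp L) (Fin (n + n)),
      adelicMpCont.omega (Fp L) (Fin (n + n)) (gramDA L e dV hdV dW hdW) (sD (inlG L e dV hdV dW hdW g))
          (piSchwartzBruhatEquiv (Fp L) (Fin (n + n)) (schwartzReindexCLM (Fp L) (e₂ (n := n)) (archBoxTensor a₁ a₂) ⊗ₜ f')) =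
        c • piSchwartzBruhatEquiv (Fp L) (Fin (n + n)) (schwartzReindexCLM (Fp L) (e₂ (n := n)) (archBoxTensor a₁' a₂) ⊗ₜ f'))
    (f₁ : FinSB (Fp L) (Fin n)) {f₂ : FinSB (Fp L) (Fin n)} (hne : piSchwartzBruhatEquiv (Fp L) (Fin n) (a₂ ⊗ₜ f₂) ≠ 0) :
    adelicMpCont.omega (Fp L) (Fin n) (gramA L e dV hdV dW hdW) (undouble L e dV hdV hdV0 dW hdW hdW0 hproj g)
        (piSchwartzBruhatEquiv (Fp L) (Fin n) (a₁ ⊗ₜ f₁)) =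
      c • piSchwartzBruhatEquiv (Fp L) (Fin n) (a₁' ⊗ₜ f₁) :=
  tensorToSum_left_cancel hne
    ((omega_uD_tensorToSum L e dV hdV hdV0 dW hdW hdW0 hproj g (piSchwartzBruhatEquiv (Fp L) (Fin n) (a₁ ⊗ₜ f₁))
      (piSchwartzBruhatEquiv (Fp L) (Fin n) (a₂ ⊗ₜ f₂))).symm.trans
      (omega_uD_tensorToSum_tmul_of_arch_box L e dV hdV dW hdW sD g hA f₁ f₂))

/-- **operator form**: if `ω(sD(g ⊕ 1))(R_{e₂}(a₁ ⊠ a₂) ⊗ f′) = c • (R_{e₂}(B a₁ ⊠ a₂) ⊗ f′)` for ALL `a₁`, `f′` and one `a₂` with `a₂ ⊗ f₂ ≠ 0`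
for some `f₂`, with `B` linear, then `ω(s(g)) = c • (B ⊗ 1)` on `𝒮(𝕎(𝔸))` (pure tensors span, ★ `linearMap_ext_tensor`).
[cite: Kudla1994, §2 (doubled space, Siegel parabolic), Thm. 3.1] -/
theorem omega_undouble_eq_smul_adelicTensorEnd_of_arch (hproj : ∀ h, projD L e dV hdV dW hdW (sD h) = toSpD L e dV hdV dW hdW h)
    (g : UnitaryGroup.adelicPair (Fp L) L (IsCMField.complexConj L) N M (Matrix.diagonal dV) (Matrix.diagonal dW))
    {B : 𝓢((Fin n → mixedSpace (Fp L)), ℂ) →ₗ[ℂ] 𝓢((Fin n → mixedSpace (Fp L)), ℂ)} {a₂ : 𝓢((Fin n → mixedSpace (Fp L)), ℂ)} {c : ℂ}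
    (hA : ∀ (a₁ : 𝓢((Fin n → mixedSpace (Fp L)), ℂ)) (f' : FinSB (Fp L) (Fin (n + n))),
      adelicMpCont.omega (Fp L) (Fin (n + n)) (gramDA L e dV hdV dW hdW) (sD (inlG L e dV hdV dW hdW g))
          (piSchwartzBruhatEquiv (Fp L) (Fin (n + n)) (schwartzReindexCLM (Fp L) (e₂ (n := n)) (archBoxTensor a₁ a₂) ⊗ₜ f')) =
        c • piSchwartzBruhatEquiv (Fp L) (Fin (n + n)) (schwartzReindexCLM (Fp L) (e₂ (n := n)) (archBoxTensor (B a₁) a₂) ⊗ₜ f'))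
    {f₂ : FinSB (Fp L) (Fin n)} (hne : piSchwartzBruhatEquiv (Fp L) (Fin n) (a₂ ⊗ₜ f₂) ≠ 0) :
    (adelicMpCont.omega (Fp L) (Fin n) (gramA L e dV hdV dW hdW) (undouble L e dV hdV hdV0 dW hdW hdW0 hproj g) :
        piSchwartzBruhat (Fp L) (Fin n) →ₗ[ℂ] piSchwartzBruhat (Fp L) (Fin n)) =
      c • adelicTensorEnd B LinearMap.id :=
  linearMap_ext_tensor fun a₁ f₁ =>
    (omega_undouble_tmul_of_arch_box L e dV hdV hdV0 dW hdW hdW0 hproj g (hA a₁) f₁ hne).trans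
      (by rw [LinearMap.smul_apply, adelicTensorEnd_apply_tmul, LinearMap.id_apply])

end ReadBack

/-! ## §2 The (C♯) data: `ι_χ((u at w(v₀)) ⊗ 1_W)` on a general archimedean vector -/

section Assembly

variable (v₀ : {v : InfinitePlace (Fp L) // v.IsReal})

/-- **the doubled operator at `(placePair u) ⊕ 1` on a pure tensor is the explicit archimedean half**:
`ω(doubledWeilRep χ ((placePair u) ⊕ 1))(a ⊗ f′) = η_τ(k_{v₀,u}) • ((frameD^* sectionD(k_{v₀,u}) frameD_* a) ⊗ f′)`
(★ `archToAdelic_archKPlace`, ★ `doubledWeilRep_archToAdelic_eq_archHalfOf`, ★ `omega_archHalfOf_tmul`).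
[cite: GelbartRogawski1991, §3.1 Prop. 3.1.1 p. 455] [cite: Kudla1994, §2 (doubled space, Siegel parabolic), Thm. 3.1] -/
theorem omega_doubledWeilRep_inlG_placePair_tmul {χ : HeckeCharacter L} (hχu : χ.IsUnitary) (hχs : IsSplittingChar L 1 χ)
    {τ : InfinitePlace L → ℤ} (hτ : χ.HasUnitaryArchType τ 0) (hodd : ∀ w, Odd (τ w))
    (u : UnitaryGroup.archLocal L N (Matrix.diagonal dV) (cmPlaceOver L v₀))
    (a : 𝓢((Fin (n + n) → mixedSpace (Fp L)), ℂ)) (f' : FinSB (Fp L) (Fin (n + n))) :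
    adelicMpCont.omega (Fp L) (Fin (n + n)) (gramDA L e dV hdV dW hdW)
        (doubledWeilRep L e dV hdV hdV0 dW hdW hdW0 χ hχu hχs (inlG L e dV hdV dW hdW (placePair L dV dW v₀ u)))
        (piSchwartzBruhatEquiv (Fp L) (Fin (n + n)) (a ⊗ₜ f')) =
      (((etaD L e dV hdV dW hdW τ (archKPlace L e dV hdV dW hdW v₀ u) : ℂˣ) : ℂ)) •
        piSchwartzBruhatEquiv (Fp L) (Fin (n + n))
          (carrierConjEquiv (frameD L e dV hdV hdV0 dW hdW hdW0)
              (sectionD L e dV hdV hdV0 dW hdW hdW0 (archKPlace L e dV hdV dW hdW v₀ u)).1.2 a ⊗ₜ f') := by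
  have h1 : doubledWeilRep L e dV hdV hdV0 dW hdW hdW0 χ hχu hχs (inlG L e dV hdV dW hdW (placePair L dV dW v₀ u)) =
      archHalfOf L e dV hdV hdV0 dW hdW hdW0 τ (archKPlace L e dV hdV dW hdW v₀ u) :=
    (DFunLike.congr_arg (doubledWeilRep L e dV hdV hdV0 dW hdW hdW0 χ hχu hχs) (archToAdelic_archKPlace L e dV hdV dW hdW v₀ u)).symm.trans
      (doubledWeilRep_archToAdelic_eq_archHalfOf L e dV hdV hdV0 dW hdW hdW0 hχu hχs hτ hodd (archKPlace L e dV hdV dW hdW v₀ u))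
  exact (congrArg (fun q : MpD L e dV hdV dW hdW =>
      adelicMpCont.omega (Fp L) (Fin (n + n)) (gramDA L e dV hdV dW hdW) q (piSchwartzBruhatEquiv (Fp L) (Fin (n + n)) (a ⊗ₜ f'))) h1).trans
    (omega_archHalfOf_tmul L e dV hdV hdV0 dW hdW hdW0 τ (archKPlace L e dV hdV dW hdW v₀ u) a f')

set_option maxHeartbeats 2000000 in
-- (as in ★ `omega_chiSplitting_placePair_gaussianV_tmul`: the `show` step unifies `chiSplitting χ g` with `undouble … g` through the doubled telescope)
/-- **ONE DEFINITE PLACE THROUGH THE SPLITTING ATTACHED TO `χ`, ON A GENERAL ARCHIMEDEAN VECTOR**: for `χ` unitary with `χ|_{𝕀_{L⁺}} = ε` and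
odd unitary archimedean type `(τ, 0)`, a real place `v₀` and `u ∈ U(σ_{w(v₀)} diag dV)(ℂ)`: if Folland's section of `k_{v₀,u}` read in the
doubled frame moves the box vector `R_{e₂}(a₁ ⊠ a₂)` to `c • R_{e₂}(a₁′ ⊠ a₂)`, and `a₂ ⊗ f₂ ≠ 0`, then
`ω(ι_χ(placePair u))(a₁ ⊗ f) = (η_τ(k_{v₀,u}) c) • (a₁′ ⊗ f)` for every finite vector `f`.  On the Gaussian (`a₁ = a₂ = a₁′ = G_𝕍`,
`c = vac (sectionD k_{v₀,u})`) this is (J-plc-G) ★ `omega_chiSplitting_placePair_gaussianV_tmul`.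
[cite: GelbartRogawski1991, §3.1 Prop. 3.1.1 p. 455, Remark p. 457 L9–13] [cite: Kudla1994, §3 Thm. 3.1] [cite: KonnoKonno2007, Lemma 5.2 p. 73] -/
theorem omega_chiSplitting_placePair_tmul_of_box {χ : HeckeCharacter L} (hχu : χ.IsUnitary) (hχs : IsSplittingChar L 1 χ)
    {τ : InfinitePlace L → ℤ} (hτ : χ.HasUnitaryArchType τ 0) (hodd : ∀ w, Odd (τ w))
    (u : UnitaryGroup.archLocal L N (Matrix.diagonal dV) (cmPlaceOver L v₀))
    {a₁ a₁' a₂ : 𝓢((Fin n → mixedSpace (Fp L)), ℂ)} {c : ℂ}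
    (hS : carrierConjEquiv (frameD L e dV hdV hdV0 dW hdW hdW0)
        (sectionD L e dV hdV hdV0 dW hdW hdW0 (archKPlace L e dV hdV dW hdW v₀ u)).1.2
          (schwartzReindexCLM (Fp L) (e₂ (n := n)) (archBoxTensor a₁ a₂)) =
      c • schwartzReindexCLM (Fp L) (e₂ (n := n)) (archBoxTensor a₁' a₂))
    (f : FinSB (Fp L) (Fin n)) {f₂ : FinSB (Fp L) (Fin n)} (hne : piSchwartzBruhatEquiv (Fp L) (Fin n) (a₂ ⊗ₜ f₂) ≠ 0) :
    adelicMpCont.omega (Fp L) (Fin n) (gramA L e dV hdV dW hdW)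
        (chiSplitting L e dV hdV hdV0 dW hdW hdW0 χ hχu hχs (placePair L dV dW v₀ u))
        (piSchwartzBruhatEquiv (Fp L) (Fin n) (a₁ ⊗ₜ f)) =
      ((((etaD L e dV hdV dW hdW τ (archKPlace L e dV hdV dW hdW v₀ u) : ℂˣ) : ℂ)) * c) •
        piSchwartzBruhatEquiv (Fp L) (Fin n) (a₁' ⊗ₜ f) := by
  show adelicMpCont.omega (Fp L) (Fin n) (gramA L e dV hdV dW hdW)
      (undouble L e dV hdV hdV0 dW hdW hdW0 (isDoubledWeilRep_doubledWeilRep L e dV hdV hdV0 dW hdW hdW0 χ hχu hχs).proj_eq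
        (placePair L dV dW v₀ u)) _ = _
  refine omega_undouble_tmul_of_arch_box L e dV hdV hdV0 dW hdW hdW0 _ (placePair L dV dW v₀ u) (fun f' => ?_) f hne
  rw [omega_doubledWeilRep_inlG_placePair_tmul L e dV hdV hdV0 dW hdW hdW0 v₀ hχu hχs hτ hodd u, hS, ← TensorProduct.smul_tmul',
    LinearEquiv.map_smul, smul_smul]

/-- **operator form**: if Folland's section of `k_{v₀,u}` read in the doubled frame moves EVERY box vector `R_{e₂}(a₁ ⊠ a₂)` (one `a₂ ≠ 0`) to
`c • R_{e₂}(B a₁ ⊠ a₂)` with `B` linear (and `a₂ ⊗ f₂ ≠ 0` for one `f₂`), then `ω(ι_χ(placePair u)) = (η_τ(k_{v₀,u}) c) • (B ⊗ 1)` on `𝒮(𝕎(𝔸))`.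
[cite: GelbartRogawski1991, §3.1 Prop. 3.1.1 p. 455] [cite: Kudla1994, §3 Thm. 3.1] -/
theorem omega_chiSplitting_placePair_eq_smul_adelicTensorEnd {χ : HeckeCharacter L} (hχu : χ.IsUnitary) (hχs : IsSplittingChar L 1 χ)
    {τ : InfinitePlace L → ℤ} (hτ : χ.HasUnitaryArchType τ 0) (hodd : ∀ w, Odd (τ w))
    (u : UnitaryGroup.archLocal L N (Matrix.diagonal dV) (cmPlaceOver L v₀))
    {B : 𝓢((Fin n → mixedSpace (Fp L)), ℂ) →ₗ[ℂ] 𝓢((Fin n → mixedSpace (Fp L)), ℂ)} {a₂ : 𝓢((Fin n → mixedSpace (Fp L)), ℂ)} {c : ℂ}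
    (hS : ∀ a₁ : 𝓢((Fin n → mixedSpace (Fp L)), ℂ),
      carrierConjEquiv (frameD L e dV hdV hdV0 dW hdW hdW0)
          (sectionD L e dV hdV hdV0 dW hdW hdW0 (archKPlace L e dV hdV dW hdW v₀ u)).1.2
            (schwartzReindexCLM (Fp L) (e₂ (n := n)) (archBoxTensor a₁ a₂)) =
        c • schwartzReindexCLM (Fp L) (e₂ (n := n)) (archBoxTensor (B a₁) a₂))
    {f₂ : FinSB (Fp L) (Fin n)} (hne : piSchwartzBruhatEquiv (Fp L) (Fin n) (a₂ ⊗ₜ f₂) ≠ 0) :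
    (adelicMpCont.omega (Fp L) (Fin n) (gramA L e dV hdV dW hdW)
        (chiSplitting L e dV hdV hdV0 dW hdW hdW0 χ hχu hχs (placePair L dV dW v₀ u)) :
        piSchwartzBruhat (Fp L) (Fin n) →ₗ[ℂ] piSchwartzBruhat (Fp L) (Fin n)) =
      ((((etaD L e dV hdV dW hdW τ (archKPlace L e dV hdV dW hdW v₀ u) : ℂˣ) : ℂ)) * c) • adelicTensorEnd B LinearMap.id :=
  linearMap_ext_tensor fun a₁ f =>
    (omega_chiSplitting_placePair_tmul_of_box L e dV hdV hdV0 dW hdW hdW0 v₀ hχu hχs hτ hodd u (hS a₁) f hne).trans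
      (by rw [LinearMap.smul_apply, adelicTensorEnd_apply_tmul, LinearMap.id_apply])

end Assembly

/-! ## §3 Through `pairRep … (adelicSingle (w(v₀)) u, 1)` and at the hermitian line `⟨T_W⟩` -/

section Pair

variable (v₀ : {v : InfinitePlace (Fp L) // v.IsReal})

/-- `pairSplitting (chiSplitting χ) (adelicSingle u, 1) = chiSplitting χ (placePair u)` (★ `pairSplitting_apply`; `adelicInr 1 = 1`).
[cite: BorelJacquet1979, §4.1] -/
theorem pairSplitting_chiSplitting_adelicSingle_one {χ : HeckeCharacter L} (hχu : χ.IsUnitary) (hχs : IsSplittingChar L 1 χ)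
    (u : UnitaryGroup.archLocal L N (Matrix.diagonal dV) (cmPlaceOver L v₀)) :
    pairSplitting (Fp L) L (IsCMField.complexConj L) N M e (Matrix.diagonal dV) (Matrix.diagonal dW)
        (chiSplitting L e dV hdV hdV0 dW hdW hdW0 χ hχu hχs)
        (UnitaryGroup.adelicSingle (Fp L) L (IsCMField.complexConj L) N (Matrix.diagonal dV) (IsCMField.complexConj_ne_one L)
          (complexConj_smul_infinitePlace L) (cmPlaceOver L v₀) u, 1) =
      chiSplitting L e dV hdV hdV0 dW hdW hdW0 χ hχu hχs (placePair L dV dW v₀ u) := by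
  have h1 : UnitaryGroup.adelicInl (Fp L) L (IsCMField.complexConj L) N M (Matrix.diagonal dV) (Matrix.diagonal dW)
        (UnitaryGroup.adelicSingle (Fp L) L (IsCMField.complexConj L) N (Matrix.diagonal dV) (IsCMField.complexConj_ne_one L)
          (complexConj_smul_infinitePlace L) (cmPlaceOver L v₀) u) *
      UnitaryGroup.adelicInr (Fp L) L (IsCMField.complexConj L) N M (Matrix.diagonal dV) (Matrix.diagonal dW) 1 =
      placePair L dV dW v₀ u := by
    rw [MonoidHom.map_one, mul_one]
  exact (pairSplitting_apply (Fp L) L (IsCMField.complexConj L) N M e (Matrix.diagonal dV) (Matrix.diagonal dW) _ _).trans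
    (congrArg (chiSplitting L e dV hdV hdV0 dW hdW hdW0 χ hχu hχs) h1)

/-- **ONE DEFINITE PLACE THROUGH `pairRep … (chiSplitting χ)`, GENERAL ARCHIMEDEAN VECTOR**: under the box hypothesis on Folland's section of
`k_{v₀,u}`, `(adelicSingle (w(v₀)) u, 1)` acts on `a₁ ⊗ f` by `(η_τ(k_{v₀,u}) c) • (a₁′ ⊗ f)`.
[cite: GelbartRogawski1991, §3.1 Prop. 3.1.1 p. 455] [cite: KonnoKonno2007, Lemma 5.2 p. 73] -/
theorem pairRep_chiSplitting_adelicSingle_tmul_of_box {χ : HeckeCharacter L} (hχu : χ.IsUnitary) (hχs : IsSplittingChar L 1 χ)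
    {τ : InfinitePlace L → ℤ} (hτ : χ.HasUnitaryArchType τ 0) (hodd : ∀ w, Odd (τ w))
    (u : UnitaryGroup.archLocal L N (Matrix.diagonal dV) (cmPlaceOver L v₀))
    {a₁ a₁' a₂ : 𝓢((Fin n → mixedSpace (Fp L)), ℂ)} {c : ℂ}
    (hS : carrierConjEquiv (frameD L e dV hdV hdV0 dW hdW hdW0)
        (sectionD L e dV hdV hdV0 dW hdW hdW0 (archKPlace L e dV hdV dW hdW v₀ u)).1.2
          (schwartzReindexCLM (Fp L) (e₂ (n := n)) (archBoxTensor a₁ a₂)) =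
      c • schwartzReindexCLM (Fp L) (e₂ (n := n)) (archBoxTensor a₁' a₂))
    (f : FinSB (Fp L) (Fin n)) {f₂ : FinSB (Fp L) (Fin n)} (hne : piSchwartzBruhatEquiv (Fp L) (Fin n) (a₂ ⊗ₜ f₂) ≠ 0) :
    pairRep (Fp L) L (IsCMField.complexConj L) N M e (Matrix.diagonal dV) (Matrix.diagonal dW)
        (chiSplitting L e dV hdV hdV0 dW hdW hdW0 χ hχu hχs)
        (UnitaryGroup.adelicSingle (Fp L) L (IsCMField.complexConj L) N (Matrix.diagonal dV) (IsCMField.complexConj_ne_one L)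
          (complexConj_smul_infinitePlace L) (cmPlaceOver L v₀) u, 1)
        (piSchwartzBruhatEquiv (Fp L) (Fin n) (a₁ ⊗ₜ f)) =
      ((((etaD L e dV hdV dW hdW τ (archKPlace L e dV hdV dW hdW v₀ u) : ℂˣ) : ℂ)) * c) •
        piSchwartzBruhatEquiv (Fp L) (Fin n) (a₁' ⊗ₜ f) :=
  (congrArg (fun q => adelicMpCont.omega (Fp L) (Fin n) (gramA L e dV hdV dW hdW) q (piSchwartzBruhatEquiv (Fp L) (Fin n) (a₁ ⊗ₜ f)))
      (pairSplitting_chiSplitting_adelicSingle_one L e dV hdV hdV0 dW hdW hdW0 v₀ hχu hχs u)).trans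
    (omega_chiSplitting_placePair_tmul_of_box L e dV hdV hdV0 dW hdW hdW0 v₀ hχu hχs hτ hodd u hS f hne)

end Pair

section Line

open Literature.NumberTheory.Automorphic.Liu2021.Def411WeilCarriersDoubling (chiSplittingLine lineW complexConj_lineW lineW_ne_zero
  realDiagonal_lineW diagonal_lineW)

variable (v₀ : {v : InfinitePlace (Fp L) // v.IsReal}) (e₁ : Fin N × Fin 1 ≃ Fin n)

/-- **ONE DEFINITE PLACE AT THE HERMITIAN LINE `⟨T_W⟩`, GENERAL ARCHIMEDEAN VECTOR** (`dW := lineW T_W`; ★ `pairRep_splittingCongr_inl_one`):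
through `ω_ψ ∘ ι_χ`, `ι_χ = chiSplittingLine χ T_W J_W`, under the box hypothesis on Folland's section of `k_{v₀,u}`, the element
`(adelicSingle (w(v₀)) u, 1)` acts on `a₁ ⊗ f` by `(η_τ(k_{v₀,u}) c) • (a₁′ ⊗ f)` — the currency of node Cc's theta functional
(★ `ThetaLiftFromLineCompactInvariance`). [cite: GelbartRogawski1991, §3.1 Prop. 3.1.1 p. 455] [cite: Liu2021, App. D Lem. D.2 (1)] -/
theorem pairRep_chiSplittingLine_adelicSingle_tmul_of_box {χ : HeckeCharacter L} (hχu : χ.IsUnitary) (hχs : IsSplittingChar L 1 χ)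
    {τ : InfinitePlace L → ℤ} (hτ : χ.HasUnitaryArchType τ 0) (hodd : ∀ w, Odd (τ w))
    (TW : Matrix (Fin 1) (Fin 1) (Fp L)) (hWd : IsUnit TW.det) (JW : Matrix (Fin 1) (Fin 1) L) (hJW : JW = TW.map (algebraMap (Fp L) L))
    (u : UnitaryGroup.archLocal L N (Matrix.diagonal dV) (cmPlaceOver L v₀))
    {a₁ a₁' a₂ : 𝓢((Fin n → mixedSpace (Fp L)), ℂ)} {c : ℂ}
    (hS : carrierConjEquiv (frameD L e₁ dV hdV hdV0 (lineW L TW) (complexConj_lineW L TW) (lineW_ne_zero L TW hWd))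
        (sectionD L e₁ dV hdV hdV0 (lineW L TW) (complexConj_lineW L TW) (lineW_ne_zero L TW hWd)
          (archKPlace L e₁ dV hdV (lineW L TW) (complexConj_lineW L TW) v₀ u)).1.2
          (schwartzReindexCLM (Fp L) (e₂ (n := n)) (archBoxTensor a₁ a₂)) =
      c • schwartzReindexCLM (Fp L) (e₂ (n := n)) (archBoxTensor a₁' a₂))
    (f : FinSB (Fp L) (Fin n)) {f₂ : FinSB (Fp L) (Fin n)} (hne : piSchwartzBruhatEquiv (Fp L) (Fin n) (a₂ ⊗ₜ f₂) ≠ 0) :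
    pairRep (Fp L) L (IsCMField.complexConj L) N 1 e₁ (Matrix.diagonal dV) JW
        (chiSplittingLine L e₁ dV hdV hdV0 χ hχu hχs TW hWd JW hJW)
        (UnitaryGroup.adelicSingle (Fp L) L (IsCMField.complexConj L) N (Matrix.diagonal dV) (IsCMField.complexConj_ne_one L)
          (complexConj_smul_infinitePlace L) (cmPlaceOver L v₀) u, 1)
        (piSchwartzBruhatEquiv (Fp L) (Fin n) (a₁ ⊗ₜ f)) =
      ((((etaD L e₁ dV hdV (lineW L TW) (complexConj_lineW L TW) τ
            (archKPlace L e₁ dV hdV (lineW L TW) (complexConj_lineW L TW) v₀ u) : ℂˣ) : ℂ)) * c) •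
        piSchwartzBruhatEquiv (Fp L) (Fin n) (a₁' ⊗ₜ f) :=
  (pairRep_splittingCongr_inl_one (IsCMField.complexConj L) e₁ (Matrix.diagonal dV) (realDiagonal_lineW L TW)
      (diagonal_lineW L TW hJW) _ _ _).trans
    (pairRep_chiSplitting_adelicSingle_tmul_of_box L e₁ dV hdV hdV0 (lineW L TW) (complexConj_lineW L TW)
      (lineW_ne_zero L TW hWd) v₀ hχu hχs hτ hodd u hS f hne)

end Line

end Literature.NumberTheory.GelbartRogawski1991.GRConstruction

end
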